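import Literature.AnabelianGeometry.SemiGraphs.TemperedVerticialDistinctSameVertex
import Literature.AnabelianGeometry.SemiGraphs.TemperedVerticialExistsProofs
import Literature.AnabelianGeometry.SemiGraphs.TemperedFunctorialitySlimProofs
import HarnessLib

/-!
# [SemiAnbd] Proposition 3.6 (iv), last sentence: verticial homomorphisms are relatively
# temp-slim, and `B^temp(G)` is temp-slim — proofs

Mochizuki, *Semi-graphs of anabelioids*, Publ. RIMS **42** (2006), §3, manuscript p. 39
[cite: MochizukiSemiAnbd2006, Prop 3.6(iv) p.39]: "if the original morphism … is locally open, then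
this morphism of temperoids is relatively temp-slim.  In particular, the temperoid `B^temp(G)` is
temp-slim."  Print (p. 40): "follows, in light of the injection of assertion (iii), formally from
Corollary 2.7, (ii)".  Here the VERTEX case — every verticial homomorphism
`ψ : Π_v → π₁^temp(G)` (Thm. 3.7 (i)) is relatively temp-slim (Def. 3.4 (ii): the centraliser in
`π₁^temp(G)` of the image of every open subgroup of `Π_v` is trivial) — is proved directly from
Theorem 3.7 (ii), same vertex (`relIndex_conj_eq_zero`, `TemperedVerticialDistinctSameVertex.lean`),
the injectivity of `ψ` (`verticialHom_injective`) and the slimness of `Π_v` (Def. 2.4 (ii)): an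
element `z` centralising `ψ(W)`, `W ⊆ Π_v` open, satisfies `ψ(W) ⊆ H ∩ zHz⁻¹` (`H = ψ(Π_v)`), a
subgroup of finite index of `H`, so `z ∈ H` by Thm. 3.7 (ii); then `z = ψ(γ)` with `γ` centralising
`W`, whence `γ = 1`.  Consequently (`temperedPiSlim_of`) the named fact `TemperedPiSlim` ("`B^temp(G)`
is temp-slim") REDUCES to Proposition 3.2 (`TemperoidHomEqRes`, through the existence of one
verticial homomorphism, `exists_isVerticialHom_of`).  Proof-only; no statement of the paper is
strengthened; nothing here takes a side on any disputed step.
-/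

open CategoryTheory Topology

namespace Literature.AnabelianGeometry.SemiGraphs

namespace ProfiniteSemiGraph

open Literature.AlgebraicGeometry.Frobenioids (IsSlimGroup)

universe u

variable {𝒢 : ProfiniteSemiGraph.{u}}

/-- **Proposition 3.6 (iv), vertex case: verticial homomorphisms are relatively temp-slim**
([SemiAnbd] p. 39 with Def. 3.4 (ii) p. 36): for `G` as in Proposition 3.6, a chart `c` and a
verticial `ψ : Π_v → π₁^temp(G)`, the centraliser in `π₁^temp(G)` of `ψ(W)` is trivial for every open
subgroup `W ⊆ Π_v`. [cite: MochizukiSemiAnbd2006, Prop 3.6(iv) p.39] -/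
theorem isRelativelyTempSlim_of_isVerticialHom (h𝒢 : 𝒢.Prop36Hypotheses) (c : TemperedPiChart 𝒢)
    (v : 𝒢.graph.Vertex) {ψ : 𝒢.Gv v →ₜ* c.G} (hψ : IsVerticialHom c v ψ) :
    IsRelativelyTempSlim ψ := by
  classical
  refine ⟨fun W hW => ?_⟩
  have hinj : Function.Injective ψ := verticialHom_injective h𝒢.isQuasiCoherent c v ψ hψ
  set H : Subgroup c.G := ψ.toMonoidHom.range with hHdef
  refine (Subgroup.eq_bot_iff_forall _).mpr fun z hz => ?_
  rw [Subgroup.mem_centralizer_iff] at hz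
  -- `ψ(W) ⊆ H ∩ z H z⁻¹`
  have hle : W.map ψ.toMonoidHom ≤ H.map (MulAut.conj z).toMonoidHom := by
    rintro x ⟨w, hw, rfl⟩
    refine ⟨ψ w, ⟨w, rfl⟩, ?_⟩
    have := hz (ψ w) ⟨w, hw, rfl⟩
    change z * ψ w * z⁻¹ = ψ.toMonoidHom w
    rw [← this, mul_inv_cancel_right]
    rfl
  -- `[H : ψ(W)] = [Π_v : W] < ∞`
  haveI : Finite (𝒢.Gv v ⧸ W) := Subgroup.quotient_finite_of_isOpen W hW
  haveI : W.FiniteIndex := Subgroup.finiteIndex_of_finite_quotient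
  have hWH : (W.map ψ.toMonoidHom).relIndex H ≠ 0 := by
    rw [hHdef, MonoidHom.range_eq_map, Subgroup.relIndex_map_map_of_injective _ _ hinj,
      Subgroup.relIndex_top_right]
    exact Subgroup.FiniteIndex.index_ne_zero
  -- hence `[H : H ∩ zHz⁻¹] < ∞`, so `z ∈ H` by Theorem 3.7 (ii)
  have hzH : z ∈ H := by
    by_contra hzH
    exact hWH (Subgroup.relIndex_eq_zero_of_le_left hle (relIndex_conj_eq_zero h𝒢 c v hψ hzH))
  obtain ⟨γ, rfl⟩ := hzH
  -- `γ` centralises `W`, hence `γ = 1` by the slimness of `Π_v`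
  have hγ : γ ∈ Subgroup.centralizer (W : Set (𝒢.Gv v)) := by
    rw [Subgroup.mem_centralizer_iff]
    intro w hw
    apply hinj
    have := hz (ψ w) ⟨w, hw, rfl⟩
    change ψ.toMonoidHom w * ψ.toMonoidHom γ = ψ.toMonoidHom γ * ψ.toMonoidHom w at this
    rw [← map_mul, ← map_mul] at this
    exact this
  have hslim := (h𝒢.isVerticiallySlim v).centralizer_eq_bot W hW
  rw [hslim, Subgroup.mem_bot] at hγ
  change ψ γ = 1
  rw [hγ, map_one]

/-- **Proposition 3.6 (iv), last sentence** ("`B^temp(G)` is temp-slim": every tempered fundamental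
group of `G` is slim) for a chart admitting a verticial homomorphism at some vertex: the centraliser
of an open `U ⊆ π₁^temp(G)` centralises `ψ(ψ⁻¹ U)`, hence is trivial.
[cite: MochizukiSemiAnbd2006, Prop 3.6(iv) p.39] -/
theorem isSlimGroup_of_isVerticialHom (h𝒢 : 𝒢.Prop36Hypotheses) (c : TemperedPiChart 𝒢)
    (v : 𝒢.graph.Vertex) {ψ : 𝒢.Gv v →ₜ* c.G} (hψ : IsVerticialHom c v ψ) : IsSlimGroup c.G := by
  refine ⟨fun U hU => ?_⟩
  have hW : IsOpen ((U.comap ψ.toMonoidHom : Subgroup (𝒢.Gv v)) : Set (𝒢.Gv v)) :=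
    hU.preimage ψ.continuous
  have h1 := (isRelativelyTempSlim_of_isVerticialHom h𝒢 c v hψ).centralizer_eq_bot _ hW
  refine le_antisymm ?_ bot_le
  rw [← h1]
  exact Subgroup.centralizer_le (Subgroup.map_comap_le ψ.toMonoidHom U)

/-- **Proposition 3.6 (iv), last sentence** — the named fact `TemperedPiSlim` ("`B^temp(G)` is
temp-slim", i.e. every tempered fundamental group of a `G` as in Prop. 3.6 is slim) REDUCED to
Proposition 3.2 (`TemperoidHomEqRes`), which provides a verticial homomorphism at the vertex that
`G` has. [cite: MochizukiSemiAnbd2006, Prop 3.6(iv) p.39] -/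
theorem temperedPiSlim_of
    (hRes : ∀ (G₁ : Type u) [Group G₁] [TopologicalSpace G₁] (G₂ : Type u) [Group G₂]
      [TopologicalSpace G₂], TemperoidHomEqRes G₁ G₂) :
    TemperedPiSlim.{u} := by
  intro 𝒢 h𝒢 c
  obtain ⟨v⟩ := h𝒢.hasVertex
  obtain ⟨ψ, hψ⟩ :=
    exists_isVerticialHom_of c v (hRes _ _) h𝒢.isQuasiCoherent h𝒢.isGaloisCountable
  exact isSlimGroup_of_isVerticialHom h𝒢 c v hψ

/-- The residual `VerticialHomRelativelyTempSlim` of the Prop. 3.6 (iv) clause-2 reduction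
(`TemperedFunctorialitySlimProofs.lean`, seat abc-iut-L3-t6; ruling η2) DISCHARGED given the
existence of verticial homomorphisms (Thm. 3.7 (i), existence half): the slimness conjunct is
`isRelativelyTempSlim_of_isVerticialHom`. [cite: MochizukiSemiAnbd2006, Prop 3.6(iv) p.39] -/
theorem verticialHomRelativelyTempSlim_of (h𝒢 : 𝒢.Prop36Hypotheses) (c : TemperedPiChart 𝒢)
    (hex : ∀ v : 𝒢.graph.Vertex, ∃ ψ : 𝒢.Gv v →ₜ* c.G, IsVerticialHom c v ψ) :
    VerticialHomRelativelyTempSlim 𝒢 c := fun v => by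
  obtain ⟨ψ, hψ⟩ := hex v
  exact ⟨ψ, hψ, isRelativelyTempSlim_of_isVerticialHom h𝒢 c v hψ⟩

/-- The same residual REDUCED to Proposition 3.2 alone (`TemperoidHomEqRes`, which supplies the
verticial homomorphisms: `exists_isVerticialHom_of`). [cite: MochizukiSemiAnbd2006, Prop 3.6(iv) p.39] -/
theorem verticialHomRelativelyTempSlim_of_temperoidHomEqRes
    (hRes : ∀ (G₁ : Type u) [Group G₁] [TopologicalSpace G₁] (G₂ : Type u) [Group G₂]
      [TopologicalSpace G₂], TemperoidHomEqRes G₁ G₂)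
    (h𝒢 : 𝒢.Prop36Hypotheses) (c : TemperedPiChart 𝒢) : VerticialHomRelativelyTempSlim 𝒢 c :=
  verticialHomRelativelyTempSlim_of h𝒢 c fun v =>
    exists_isVerticialHom_of c v (hRes _ _) h𝒢.isQuasiCoherent h𝒢.isGaloisCountable

end ProfiniteSemiGraph

end Literature.AnabelianGeometry.SemiGraphs
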